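import Summits.CriticalPhenomena.Ising3DConformalLimit.Theorems.RotationJoining.Negative.RotationJoiningFalseWithoutGibbs

/-!
# `RotationJoining` (crux stmt-CriticalPhenomena-18763), negative-side support, module 6:
# the picked line's stub `AsymptoticFDDIsotropy` is FALSE without the Gibbs hypothesis

Line `SketchIdeator2` (card rate-from-dilations-splitting) reduces the crux to two dilation-joining stubs and
the rate-free, coupling-free `AsymptoticFDDIsotropy` (`Theorems/SynchronousCouplingDefs.lean`): for every
finite window of blocks and every bounded `1`-Lipschitz test, the expectations of the self-normalised
ROTATED-cell block field and of the AXIS-cell block field have the same limit as `n → ∞`. Here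
(`asymptoticFDDIsotropy_false_without_gibbs`, in this lane's vocabulary — `tiltCell = rotCell`,
`normTilt μ n m = normaliser μ (rotCell n m 0)`, `normAxis μ n = normaliser μ (axisCell n 0)` are the same
terms, and `rotCell n m 0 = rotCell₀ n m`): with `μ ∈ 𝒢(β_c)` weakened to "translation-invariant probability
measure" that statement is FALSE. Witness: the layered i.i.d. measure `μL` of module 4, window `(0, e₀)`,
test `ftest v = min(|v₀ − v₁|, 1)/2`; the axis reading is `0` (the two axis blocks coincide), the rotated
reading is `≥ 97/5000` at every `n = 3k` (`integral_min_abs_Dk_ge`: Khintchine's fourth-moment bound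
`E(Σ c_j ε_j)⁴ ≤ 3 (Σ c_j²)²`, `integral_pow_four_linear_P_le`, by induction on the support, and the
truncation inequality `min(|x|,1) ≥ τx² − τ²x⁴/4`, `min_abs_one_ge`). So within the line the isotropy stub
is where the Gibbs/cubic-symmetry input must enter. Refuter cdisprove seat (cycle 1); refutes nothing.
-/

namespace Summit.CriticalPhenomena.Ising3DConformalLimit.Theorems.RotationJoining.Negative

open MeasureTheory Filter Finset
open Literature.Probability.LatticeModels

noncomputable section

/-- Khintchine-type fourth moment bound for Rademacher linear forms: `E[(Σ c_j ε_j)⁴] ≤ 3 (Σ c_j²)²`. -/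
theorem integral_pow_four_linear_P_le (K : Finset ℤ) (c : ℤ → ℝ) :
    ∫ ε, (∑ j ∈ K, c j * spinAt j ε) ^ 4 ∂P ≤ 3 * (∑ j ∈ K, c j ^ 2) ^ 2 := by
  classical
  induction K using Finset.induction_on with
  | empty => simp
  | @insert a K ha ih =>
    -- notation
    set S : (ℤ → ℤˣ) → ℝ := fun ε => ∑ j ∈ K, c j * spinAt j ε with hS
    have hSm : Measurable S := by rw [hS]; fun_prop
    have hSb : ∀ ε, |S ε| ≤ ∑ j ∈ K, |c j| := by
      intro ε
      rw [hS]
      refine (Finset.abs_sum_le_sum_abs _ _).trans (Finset.sum_le_sum fun j _ => ?_)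
      rw [abs_mul, abs_spinAt, mul_one]
    have hdepS : DependsOn S (K : Set ℤ) := by
      intro x y hxy
      simp only [hS]
      refine Finset.sum_congr rfl fun j hj => ?_
      simp only [spinAt, hxy j (by exact_mod_cast hj)]
    have hdepa : DependsOn (fun ε : ℤ → ℤˣ => spinAt a ε) (({a} : Finset ℤ) : Set ℤ) := by
      intro x y hxy; simp only [spinAt, hxy a (by simp)]
    have hdisj : Disjoint K {a} := Finset.disjoint_singleton_right.2 ha
    -- integrability of bounded measurable functions on the probability space `P`
    have hint : ∀ {g : (ℤ → ℤˣ) → ℝ}, Measurable g → ∀ B : ℝ, (∀ ε, |g ε| ≤ B) → Integrable g P :=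
      fun hg B hB => Integrable.of_bound hg.aestronglyMeasurable B
        (ae_of_all _ (fun ε => by rw [Real.norm_eq_abs]; exact hB ε))
    set B : ℝ := ∑ j ∈ K, |c j| with hB
    have hBnn : 0 ≤ B := Finset.sum_nonneg (fun j _ => abs_nonneg _)
    -- moments of the new coordinate against powers of S
    have hE2 : ∫ ε, S ε ^ 2 ∂P = ∑ j ∈ K, c j ^ 2 := by rw [hS]; exact integral_sq_linear_P K c
    have h31 : ∫ ε, S ε ^ 3 * spinAt a ε ∂P = 0 := by
      have := integral_mul_eq_of_dependsOn_disjoint (fun _ : ℤ => coin) hdisj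
        (hSm.pow_const 3) (measurable_spinAt a)
        (fun x y hxy => by simp only [hdepS hxy]) hdepa
      unfold P at this ⊢
      rw [this]
      change (∫ ε, S ε ^ 3 ∂P) * ∫ ε, spinAt a ε ∂P = 0
      rw [integral_spinAt_P, mul_zero]
    have h13 : ∫ ε, S ε * spinAt a ε ^ 3 ∂P = 0 := by
      have hcube : ∀ ε : ℤ → ℤˣ, spinAt a ε ^ 3 = spinAt a ε := fun ε => by
        rcases spinAt_eq_one_or_eq_neg_one a ε with h | h <;> rw [h] <;> norm_num
      simp_rw [hcube]
      have := integral_mul_eq_of_dependsOn_disjoint (fun _ : ℤ => coin) hdisj hSm (measurable_spinAt a)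
        hdepS hdepa
      unfold P at this ⊢
      rw [this]
      change (∫ ε, S ε ∂P) * ∫ ε, spinAt a ε ∂P = 0
      rw [integral_spinAt_P, mul_zero]
    have h22 : ∫ ε, S ε ^ 2 * spinAt a ε ^ 2 ∂P = ∑ j ∈ K, c j ^ 2 := by
      simp_rw [spinAt_sq, mul_one]; exact hE2
    have h04 : ∫ ε, spinAt a ε ^ 4 ∂(P) = 1 := by
      have : ∀ ε : ℤ → ℤˣ, spinAt a ε ^ 4 = 1 := fun ε => by
        rw [show (4:ℕ) = 2 * 2 from rfl, pow_mul, spinAt_sq, one_pow]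
      simp [this]
    -- expand the fourth power of the sum over `insert a K`
    have hexp : ∀ ε, (∑ j ∈ insert a K, c j * spinAt j ε) ^ 4 =
        S ε ^ 4 + 4 * c a * (S ε ^ 3 * spinAt a ε) + 6 * c a ^ 2 * (S ε ^ 2 * spinAt a ε ^ 2) +
          4 * c a ^ 3 * (S ε * spinAt a ε ^ 3) + c a ^ 4 * spinAt a ε ^ 4 := by
      intro ε
      rw [Finset.sum_insert ha, hS]
      ring
    simp_rw [hexp]
    have iS4 : Integrable (fun ε => S ε ^ 4) P :=
      hint (hSm.pow_const 4) (B ^ 4) (fun ε => by rw [abs_pow]; exact pow_le_pow_left₀ (abs_nonneg _) (hSb ε) 4)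
    have iS3a : Integrable (fun ε => S ε ^ 3 * spinAt a ε) P :=
      hint ((hSm.pow_const 3).mul (measurable_spinAt a)) (B ^ 3) (fun ε => by
        rw [abs_mul, abs_spinAt, mul_one, abs_pow]; exact pow_le_pow_left₀ (abs_nonneg _) (hSb ε) 3)
    have iS2a : Integrable (fun ε => S ε ^ 2 * spinAt a ε ^ 2) P :=
      hint ((hSm.pow_const 2).mul ((measurable_spinAt a).pow_const 2)) (B ^ 2) (fun ε => by
        rw [spinAt_sq, mul_one, abs_pow]; exact pow_le_pow_left₀ (abs_nonneg _) (hSb ε) 2)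
    have iS1a : Integrable (fun ε => S ε * spinAt a ε ^ 3) P :=
      hint (hSm.mul ((measurable_spinAt a).pow_const 3)) B (fun ε => by
        rw [abs_mul, abs_pow, abs_spinAt, one_pow, mul_one]; exact hSb ε)
    have ia4 : Integrable (fun ε => spinAt a ε ^ 4) P :=
      hint ((measurable_spinAt a).pow_const 4) 1 (fun ε => by rw [abs_pow, abs_spinAt, one_pow])
    rw [integral_add, integral_add, integral_add, integral_add, integral_const_mul, integral_const_mul,
      integral_const_mul, integral_const_mul, h31, h13, h22, h04, Finset.sum_insert ha]
    · have hca : 0 ≤ c a ^ 4 := by positivity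
      nlinarith [ih, Finset.sum_nonneg (fun j (_ : j ∈ K) => sq_nonneg (c j)), sq_nonneg (c a)]
    all_goals first
      | exact iS4
      | exact (iS3a.const_mul _)
      | exact (iS2a.const_mul _)
      | exact (iS1a.const_mul _)
      | exact (ia4.const_mul _)
      | exact iS4.add (iS3a.const_mul _)
      | exact (iS4.add (iS3a.const_mul _)).add (iS2a.const_mul _)
      | exact ((iS4.add (iS3a.const_mul _)).add (iS2a.const_mul _)).add (iS1a.const_mul _)

/-- Truncation inequality: for `τ ≤ 1`, `min(|x|, 1) ≥ τ x² − τ² x⁴ / 4`. -/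
theorem min_abs_one_ge (x τ : ℝ) (h1 : τ ≤ 1) :
    τ * x ^ 2 - τ ^ 2 * x ^ 4 / 4 ≤ min |x| 1 := by
  have hle1 : τ * x ^ 2 - τ ^ 2 * x ^ 4 / 4 ≤ 1 := by nlinarith [sq_nonneg (τ * x ^ 2 - 2)]
  refine le_min ?_ hle1
  rcases le_total |x| 1 with hx | hx
  · have hx2 : x ^ 2 ≤ |x| := by
      have : x ^ 2 = |x| * |x| := by rw [← sq, sq_abs]
      rw [this]; exact mul_le_of_le_one_right (abs_nonneg x) hx
    have : τ ^ 2 * x ^ 4 / 4 ≥ 0 := by positivity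
    nlinarith [mul_le_mul h1 hx2 (sq_nonneg x) zero_le_one]
  · exact hle1.trans hx


/-- The normalised difference of the two rotated block readings of ONE copy, through the layering. -/
def Dk (k : ℕ) (ε : ℤ → ℤˣ) : ℝ :=
  normaliser μL (rotCell₀ (3 * k) 1) *
    (blockSum (rotCell₀ (3 * k) 1) (layer ε) - blockSum (rotCell (3 * k) 1 (Pi.single 0 1)) (layer ε))

/-- `D` as a normalised Rademacher linear form with the profile difference as coefficients. -/
theorem Dk_eq_linear (k : ℕ) (ε : ℤ → ℤˣ) :
    Dk k ε = normaliser μL (rotCell₀ (3 * k) 1) *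
      ∑ j ∈ Kwin k, (profile (rotCell₀ (3 * k) 1) j - profile (rotCell₀ (3 * k) 1) (j + k)) * spinAt j ε := by
  unfold Dk
  rw [blockSum_rotCell₀_layer, blockSum_rotCell_e0_layer, ← Finset.sum_sub_distrib]
  congr 1
  refine Finset.sum_congr rfl fun j _ => ?_
  ring

/-- `D` is measurable. -/
@[fun_prop]
theorem measurable_Dk (k : ℕ) : Measurable (Dk k) := by
  unfold Dk; fun_prop

/-- `D` is bounded. -/
theorem abs_Dk_le (k : ℕ) (ε : ℤ → ℤˣ) :
    |Dk k ε| ≤ |normaliser μL (rotCell₀ (3 * k) 1)| *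
      ((rotCell₀ (3 * k) 1).card + (rotCell (3 * k) 1 (Pi.single 0 1)).card) := by
  have hbs : ∀ s : Finset (Site 3), |blockSum s (layer ε)| ≤ s.card := fun s => by
    simpa only [Real.norm_eq_abs] using norm_blockSum_le s (layer ε)
  unfold Dk
  rw [abs_mul]
  refine mul_le_mul_of_nonneg_left ((abs_sub _ _).trans (add_le_add (hbs _) (hbs _)))
    (abs_nonneg _)

/-- `E[D²] = V₁/V₀`. -/
theorem integral_Dk_sq (k : ℕ) : ∫ ε, Dk k ε ^ 2 ∂P = (V0 k)⁻¹ * V1 k := by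
  unfold Dk
  simp_rw [mul_pow]
  rw [integral_const_mul, integral_sq_blockSum_sub, normaliser_rotCell₀_sq]

/-- `E[D⁴] ≤ 3 (V₁/V₀)²` (Khintchine). -/
theorem integral_Dk_pow_four_le (k : ℕ) : ∫ ε, Dk k ε ^ 4 ∂P ≤ 3 * ((V0 k)⁻¹ * V1 k) ^ 2 := by
  simp_rw [Dk_eq_linear, mul_pow]
  rw [integral_const_mul]
  have h4 : normaliser μL (rotCell₀ (3 * k) 1) ^ 4 = ((V0 k)⁻¹) ^ 2 := by
    rw [show (4:ℕ) = 2 * 2 from rfl, pow_mul, normaliser_rotCell₀_sq]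
  rw [h4]
  have hK := integral_pow_four_linear_P_le (Kwin k)
    (fun j => profile (rotCell₀ (3 * k) 1) j - profile (rotCell₀ (3 * k) 1) (j + k))
  have hV1 : ∑ j ∈ Kwin k, (profile (rotCell₀ (3 * k) 1) j - profile (rotCell₀ (3 * k) 1) (j + k)) ^ 2 = V1 k := rfl
  rw [hV1] at hK
  have hnn : 0 ≤ ((V0 k)⁻¹) ^ 2 := sq_nonneg _
  calc ((V0 k)⁻¹) ^ 2 * ∫ ε, (∑ j ∈ Kwin k, (profile (rotCell₀ (3 * k) 1) j -
        profile (rotCell₀ (3 * k) 1) (j + ↑k)) * spinAt j ε) ^ 4 ∂P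
      ≤ ((V0 k)⁻¹) ^ 2 * (3 * (V1 k) ^ 2) := mul_le_mul_of_nonneg_left hK hnn
    _ = 3 * ((V0 k)⁻¹ ^ 2 * V1 k ^ 2) := by ring

/-- KEY ESTIMATE (bounded-Lipschitz form): `E min(|D|, 1) ≥ 97/2500` at every `n = 3k`, `k ≥ 1`. -/
theorem integral_min_abs_Dk_ge {k : ℕ} (hk : 1 ≤ k) : (97:ℝ) / 2500 ≤ ∫ ε, min |Dk k ε| 1 ∂P := by
  set s2 : ℝ := (V0 k)⁻¹ * V1 k with hs2
  have hV0 : 1 ≤ V0 k := one_le_V0 hk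
  have hV0pos : 0 < V0 k := by linarith
  have hV1 : V0 k ≤ 25 * V1 k := V0_le k
  have hs2lo : (1:ℝ) / 25 ≤ s2 := by
    rw [hs2, inv_mul_eq_div, le_div_iff₀ hV0pos]; linarith
  have hs2pos : 0 < s2 := by linarith
  set τ : ℝ := 1 / (25 * s2) with hτ
  have hτ1 : τ ≤ 1 := by
    rw [hτ, div_le_one (by positivity)]; linarith
  -- integrability
  set B : ℝ := |normaliser μL (rotCell₀ (3 * k) 1)| *
      ((rotCell₀ (3 * k) 1).card + (rotCell (3 * k) 1 (Pi.single 0 1)).card) with hB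
  have hDb : ∀ ε, |Dk k ε| ≤ B := abs_Dk_le k
  have hint : ∀ {g : (ℤ → ℤˣ) → ℝ}, Measurable g → ∀ C : ℝ, (∀ ε, |g ε| ≤ C) → Integrable g P :=
    fun hg C hC => Integrable.of_bound hg.aestronglyMeasurable C
      (ae_of_all _ (fun ε => by rw [Real.norm_eq_abs]; exact hC ε))
  have i2 : Integrable (fun ε => Dk k ε ^ 2) P :=
    hint ((measurable_Dk k).pow_const 2) (B ^ 2) (fun ε => by
      rw [abs_pow]; exact pow_le_pow_left₀ (abs_nonneg _) (hDb ε) 2)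
  have i4 : Integrable (fun ε => Dk k ε ^ 4) P :=
    hint ((measurable_Dk k).pow_const 4) (B ^ 4) (fun ε => by
      rw [abs_pow]; exact pow_le_pow_left₀ (abs_nonneg _) (hDb ε) 4)
  have imin : Integrable (fun ε => min |Dk k ε| 1) P :=
    hint ((measurable_Dk k).abs.min measurable_const) 1 (fun ε => by
      rw [abs_le]; constructor
      · linarith [le_min (abs_nonneg (Dk k ε)) zero_le_one]
      · exact min_le_right _ _)
  -- pointwise truncation, integrated
  have hpt : ∀ ε, τ * Dk k ε ^ 2 - τ ^ 2 * Dk k ε ^ 4 / 4 ≤ min |Dk k ε| 1 :=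
    fun ε => min_abs_one_ge (Dk k ε) τ hτ1
  have hle : ∫ ε, (τ * Dk k ε ^ 2 - τ ^ 2 * Dk k ε ^ 4 / 4) ∂P ≤ ∫ ε, min |Dk k ε| 1 ∂P :=
    integral_mono ((i2.const_mul τ).sub ((i4.const_mul (τ ^ 2)).div_const 4)) imin hpt
  have heq : ∫ ε, (τ * Dk k ε ^ 2 - τ ^ 2 * Dk k ε ^ 4 / 4) ∂P =
      τ * ∫ ε, Dk k ε ^ 2 ∂P - τ ^ 2 * (∫ ε, Dk k ε ^ 4 ∂P) / 4 := by
    rw [integral_sub (i2.const_mul τ) ((i4.const_mul (τ ^ 2)).div_const 4), integral_const_mul,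
      integral_div, integral_const_mul]
  rw [heq, integral_Dk_sq] at hle
  have h4 := integral_Dk_pow_four_le k
  rw [← hs2] at hle h4
  -- τ s2 - τ² m4 /4 ≥ τ s2 - τ² (3 s2²)/4 = 97/2500
  have hτs : τ * s2 = 1 / 25 := by
    rw [hτ]; field_simp
  have hτnn : 0 ≤ τ ^ 2 := sq_nonneg _
  have step : τ * s2 - τ ^ 2 * (3 * s2 ^ 2) / 4 ≤ τ * s2 - τ ^ 2 * (∫ ε, Dk k ε ^ 4 ∂P) / 4 := by
    nlinarith [mul_le_mul_of_nonneg_left h4 hτnn]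
  have val : τ * s2 - τ ^ 2 * (3 * s2 ^ 2) / 4 = 97 / 2500 := by
    have : τ ^ 2 * s2 ^ 2 = (τ * s2) ^ 2 := by ring
    rw [show τ ^ 2 * (3 * s2 ^ 2) / 4 = 3 * (τ ^ 2 * s2 ^ 2) / 4 by ring, this, hτs]
    norm_num
  linarith

/-- The bounded `1`-Lipschitz test function `f(v) = min(|v₀ − v₁|, 1)/2` on a window of two blocks. -/
def ftest (v : Fin 2 → ℝ) : ℝ := min |v 0 - v 1| 1 / 2

/-- `ftest` is `1`-Lipschitz for the sup metric. -/
theorem ftest_lipschitz : LipschitzWith 1 ftest := by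
  refine LipschitzWith.of_le_add fun a b => ?_
  simp only [ftest]
  have h0 : |a 0 - b 0| ≤ dist a b := by rw [← Real.dist_eq]; exact dist_le_pi_dist a b 0
  have h1 : |a 1 - b 1| ≤ dist a b := by rw [← Real.dist_eq]; exact dist_le_pi_dist a b 1
  have hmin : min |a 0 - a 1| 1 ≤ min |b 0 - b 1| 1 + (|a 0 - b 0| + |a 1 - b 1|) := by
    have htri : |a 0 - a 1| ≤ |b 0 - b 1| + (|a 0 - b 0| + |a 1 - b 1|) := by
      have := abs_sub_le (a 0) (b 0) (a 1)
      have := abs_sub_le (b 0) (b 1) (a 1)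
      have := abs_sub_comm (b 1) (a 1)
      linarith
    rcases le_total |b 0 - b 1| 1 with hb | hb
    · rw [min_eq_left hb]
      exact (min_le_left _ _).trans htri
    · rw [min_eq_right hb]
      linarith [min_le_right |a 0 - a 1| 1, abs_nonneg (a 0 - b 0), abs_nonneg (a 1 - b 1)]
  linarith

/-- `ftest` is continuous. -/
theorem ftest_continuous : Continuous ftest := ftest_lipschitz.continuous

/-- `ftest` is bounded by `1/2`. -/
theorem abs_ftest_le (v : Fin 2 → ℝ) : |ftest v| ≤ 1 / 2 := by
  unfold ftest
  rw [abs_le]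
  constructor
  · linarith [le_min (abs_nonneg (v 0 - v 1)) zero_le_one]
  · linarith [min_le_right |v 0 - v 1| 1]

/-- LOAD-BEARING for the picked line's stub `AsymptoticFDDIsotropy` (rate-free bounded-Lipschitz isotropy of
finite block windows, here in this file's vocabulary `normaliser/rotCell/axisCell` — the line's `normTilt μ n m`
is `normaliser μ (rotCell n m 0)` and `tiltCell = rotCell`, `rotCell n m 0 = rotCell₀ n m` by `rotCell_zero`):
with the Gibbs hypothesis weakened to "translation-invariant probability measure" it is FALSE. Witness `μL`,
window `(0, e₀)`, test `ftest`: the axis reading gives `0`, the rotated reading `≥ 97/5000` at every `n = 3k`. -/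
theorem asymptoticFDDIsotropy_false_without_gibbs :
    ¬ ∀ μ : Measure (SpinConfig (Site 3)), IsProbabilityMeasure μ → IsTranslationInvariantMeasure μ →
      ∀ (j m : ℕ) (us : Fin j → (Fin 3 → ℤ)), (∀ i l, |us i l| ≤ m) →
        ∀ f : (Fin j → ℝ) → ℝ, LipschitzWith 1 f → (∃ B : ℝ, ∀ v, |f v| ≤ B) →
          Tendsto (fun n : ℕ =>
            (∫ σ, f (fun i => normaliser μ (rotCell₀ n m) * blockSum (rotCell n m (us i)) σ) ∂μ) -
              ∫ σ, f (fun i => normaliser μ (axisCell₀ n) * blockSum (axisCell n (us i)) σ) ∂μ)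
            atTop (nhds 0) := by
  intro h
  have hus : ∀ i l, |(![0, Pi.single 0 1] : Fin 2 → (Fin 3 → ℤ)) i l| ≤ ((1:ℕ):ℤ) := by
    intro i l
    fin_cases i
    · simp
    · simpa using abs_single_le l
  have H := h μL inferInstance isTranslationInvariant_μL 2 1 ![0, Pi.single 0 1] hus ftest ftest_lipschitz
    ⟨1 / 2, abs_ftest_le⟩
  -- the axis reading vanishes identically
  have haxis : ∀ n : ℕ, ∫ σ, ftest (fun i => normaliser μL (axisCell₀ n) *
      blockSum (axisCell n ((![0, Pi.single 0 1] : Fin 2 → (Fin 3 → ℤ)) i)) σ) ∂μL = 0 := by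
    intro n
    have hmeas : Measurable (fun σ : SpinConfig (Site 3) => ftest (fun i => normaliser μL (axisCell₀ n) *
        blockSum (axisCell n ((![0, Pi.single 0 1] : Fin 2 → (Fin 3 → ℤ)) i)) σ)) :=
      ftest_continuous.measurable.comp (measurable_pi_lambda _ (fun i => by fun_prop))
    rw [integral_μL hmeas]
    have : ∀ ε, ftest (fun i => normaliser μL (axisCell₀ n) *
        blockSum (axisCell n ((![0, Pi.single 0 1] : Fin 2 → (Fin 3 → ℤ)) i)) (layer ε)) = 0 := by
      intro ε
      simp [ftest, blockSum_axisCell_e0_layer, axisCell_zero]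
    simp [this]
  -- the rotated reading at n = 3k is E min(|D|,1)/2 ≥ 97/5000
  have hrot : ∀ k : ℕ, 1 ≤ k → (97:ℝ) / 5000 ≤ ∫ σ, ftest (fun i => normaliser μL (rotCell₀ (3 * k) 1) *
      blockSum (rotCell (3 * k) 1 ((![0, Pi.single 0 1] : Fin 2 → (Fin 3 → ℤ)) i)) σ) ∂μL := by
    intro k hk
    have hmeas : Measurable (fun σ : SpinConfig (Site 3) => ftest (fun i =>
        normaliser μL (rotCell₀ (3 * k) 1) *
          blockSum (rotCell (3 * k) 1 ((![0, Pi.single 0 1] : Fin 2 → (Fin 3 → ℤ)) i)) σ)) :=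
      ftest_continuous.measurable.comp (measurable_pi_lambda _ (fun i => by fun_prop))
    rw [integral_μL hmeas]
    have : ∀ ε, ftest (fun i => normaliser μL (rotCell₀ (3 * k) 1) *
        blockSum (rotCell (3 * k) 1 ((![0, Pi.single 0 1] : Fin 2 → (Fin 3 → ℤ)) i)) (layer ε)) =
        min |Dk k ε| 1 / 2 := by
      intro ε
      simp only [ftest, Dk, Matrix.cons_val_zero, Matrix.cons_val_one, rotCell_zero, mul_sub]
    simp_rw [this]
    rw [integral_div]
    have := integral_min_abs_Dk_ge hk
    linarith
  -- along n = 3k the sequence stays ≥ 97/5000, contradicting the limit 0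
  have h3' : Tendsto (fun k : ℕ => 3 * k) atTop atTop :=
    tendsto_atTop_atTop.2 (fun b => ⟨b, fun a ha => by omega⟩)
  have H3 := H.comp h3'
  have hev : ∀ᶠ k : ℕ in atTop, ((fun n : ℕ =>
      (∫ σ, ftest (fun i => normaliser μL (rotCell₀ n 1) *
          blockSum (rotCell n 1 ((![0, Pi.single 0 1] : Fin 2 → (Fin 3 → ℤ)) i)) σ) ∂μL) -
        ∫ σ, ftest (fun i => normaliser μL (axisCell₀ n) *
          blockSum (axisCell n ((![0, Pi.single 0 1] : Fin 2 → (Fin 3 → ℤ)) i)) σ) ∂μL) ∘ fun k : ℕ => 3 * k) k ∈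
      Set.Iio ((97:ℝ) / 5000) :=
    H3.eventually_mem (Iio_mem_nhds (by norm_num))
  obtain ⟨k, hk1, hk2⟩ := (hev.and (eventually_ge_atTop 1)).exists
  simp only [Function.comp_apply, Set.mem_Iio, haxis, sub_zero] at hk1
  exact absurd (hrot k hk2) (not_le.2 hk1)

end

end Summit.CriticalPhenomena.Ising3DConformalLimit.Theorems.RotationJoining.Negative
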